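import Summits.BirchSwinnertonDyer.BirchSwinnertonDyer.Theorems.ThetaPartnerAtTwoSignedKatoUpToAtTwoPlusHondaLogPairingEnum
import Summits.BirchSwinnertonDyer.BirchSwinnertonDyer.Theorems.ThetaPartnerAtTwoSignedKatoUpToAtTwoLocalTwoPlusPointsExact
import HarnessLib

/-!
# Route `ThetaPartnerAtTwo` (TP2), crux K3 `SignedKatoDivisibilityUpToAtTwo` (stmt-BirchSwinnertonDyer-20308 / K3P′ 25631), line
# `colemanrat` v13, assembly brick B4b — the BASE CASES `n = 0, 1` of the log side (R3): `Λ(d_0) = −2` and `Λ(d_1) + Λ(g₀•d_1) = 8`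
# for the displayed plus Honda system at `2`

Width seat `bsd-wall-tp2-p2x-w4` g0 (cell `bsd-wall`), brick B4b of the lead's memo `Cruxes/SignedKatoDivisibilityUpToAtTwo/G7-ASSEMBLY-v1.md`
(asked 11:24:39Z). HONEST FRAMING: theorems only (no definition, no named fact, no instance, no `sorry`); closes no item; K3 / K3P′ are NOT
settled and BSD is NOT proved by any of this.

## What

The character-value socket CORE_χ^prim asks the (ERL_χ) identity for `χ` PRIMITIVE or `n ≤ 1`. For primitive even `χ` the log half is
`LocalVar.sum_pow_mul_ptLogΩ_pow_smul_plusHondaPoint_eq` (`Σ_{j<2ⁿ} χ(5)ʲ Λ(toLoc⁻¹(g₀ʲ•d_n)) = 3τ(χ)`). The imprimitive cases with `n ≤ 1`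
are the TRIVIAL characters modulo `4` (`n = 0`) and modulo `8` (`n = 1`) (the only other even `2`-power-order character modulo `8` is
primitive). For them the log side of `χ(P_{n,d_n}(z))` is `Σ_{j<2ⁿ} Λ(toLoc⁻¹(g₀ʲ • d_n))`, computed here for the DISPLAYED system
`d_n = 3•(c_{n+2} + σ_{n+2}•c_{n+2}) − 2•c_1`, `Λ(c_m) = ℓ_m` of `PlusLayer.plusHondaSystemTwo_padic_withLog`:

* §1 `ptLogΩ_smul_plusHondaPoint_eq`: `Λ(toLoc⁻¹(ρ • d_n)) = ρ • (3(ℓ_{n+2} + σ_{n+2}•ℓ_{n+2}) − 2ℓ_1)` for every `ρ ∈ Γ_{ℚ₂}` (the lead's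
  `HondaLog.ptLogΩ_act_plusPoint` on the crux's currency, any `n`).
* §2 `ell_two_three` (`ℓ_3 = ζ_8`), `plusLog_zero_eq` (`3(ℓ_2 + σℓ_2) − 2ℓ_1 = −2`), `plusLog_one_add_smul_eq`
  (`X + g₀•X = 8` for `X = 3(ℓ_3 + σℓ_3) − 2ℓ_1`, `σζ_8 = ζ_8⁻¹`, `g₀ζ_8 = ζ_8⁵`; uses `ζ_8⁴ = −1`).
* §3 **`ptLogΩ_plusHondaPoint_zero`** (`Λ(toLoc⁻¹(d_0)) = −2`), **`ptLogΩ_plusHondaPoint_one_add_smul`** (`Λ(toLoc⁻¹(d_1)) + Λ(toLoc⁻¹(g₀•d_1)) = 8`),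
  and the two in the pairing-sum enumeration of (ERL_χ): **`sum_pow_mul_ptLogΩ_pow_smul_plusHondaPoint_eq_level_zero`** (`= −2`, any `χ` mod `4`)
  and **`sum_pow_mul_ptLogΩ_pow_smul_plusHondaPoint_eq_one_level_one`** (`= 8`, trivial `χ` mod `8`, `g₀ζ_8 = ζ_8⁵`).

References: [Kobayashi2003] §8.4 (Lemma 8.9), Prop. 8.26 (p. 25); [KuriharaOtsuki2006] §1.3 (the points at `p = 2`).
-/

set_option autoImplicit false
-- the Theorems namespace of this sub repeats the summit name by design (D-0017 nested layout)
set_option linter.dupNamespace false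

noncomputable section

open scoped Classical IntermediateField Topology NNReal NumberField

namespace Summit.BirchSwinnertonDyer.BirchSwinnertonDyer.Theorems.SignedKatoOffTwo.LocalVar

open Field WeierstrassCurve NumberField IsDedekindDomain Literature.NumberTheory.EllipticCurves
  Literature.NumberTheory.GaloisRepresentations
  Literature.NumberTheory.EllipticCurves.ZpExtension Literature.NumberTheory.EllipticCurves.Kobayashi2003
  Literature.NumberTheory.EllipticCurves.FormalGroupChart Literature.NumberTheory.EllipticCurves.Rank1Residual
  Summit.BirchSwinnertonDyer.Rank1Residual.Additive Summit.BirchSwinnertonDyer.Rank1Residual.Additive.PadicCyclotomicTower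
  Summit.BirchSwinnertonDyer.Rank1Residual.Additive.BallEval
  Summit.BirchSwinnertonDyer.BirchSwinnertonDyer.Theorems.SignedKatoOffTwo.LocalTwo
  Summit.BirchSwinnertonDyer.BirchSwinnertonDyer.Theorems.SignedKatoOffTwo.HondaLog
  Summit.BirchSwinnertonDyer.BirchSwinnertonDyer.Theorems.SignedEC.PlusLayer

/-! ## §1 The logarithm of a Galois conjugate of the displayed plus Honda point -/

section Log

variable (W : WeierstrassCurve ℚ) [W.IsElliptic] [W.IsGloballyMinimal]
  {c : ℕ → localPoints W ℚ_[2]} {σ : ℕ → Field.absoluteGaloisGroup ℚ_[2]} {d : ℕ → localPoints W ℚ_[2]}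

/-- **`Λ(toLoc⁻¹(ρ • d_n)) = ρ • (3(ℓ_{n+2} + σ_{n+2}•ℓ_{n+2}) − 2ℓ_1)`** for the displayed system (`Λ(c_m) = ℓ_m`, `c_m ∈ L(m) ∩ E₁`,
`d_n = 3•(c_{n+2} + σ_{n+2}•c_{n+2}) − 2•c_1`) and every `ρ ∈ Γ_{ℚ₂}` — the lead's `HondaLog.ptLogΩ_act_plusPoint` for the action
`act ρ := toLoc⁻¹ ∘ (ρ • ·) ∘ toLoc`. [cite: Kobayashi2003, §8.4 (Lemma 8.9), Prop. 8.26 (p. 25)] -/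
theorem ptLogΩ_smul_plusHondaPoint_eq
    (hcΩ : haveI := isIntegral_genFib_baseChange 2 ((integralModelInt W).map (Int.castRingHom ℤ_[2]))
        ∀ m, (toLoc ((genFibΩ_eq_baseChange ((integralModelInt W).map (Int.castRingHom ℤ_[2]))).trans
              (baseChange_twoAdicModel W))).symm (c m) ∈
            subfieldPoints (genFibΩ 2 ((integralModelInt W).map (Int.castRingHom ℤ_[2]))) (layer 2 m).toSubfield
              coeffs_mem_layer ∧
          (toLoc ((genFibΩ_eq_baseChange ((integralModelInt W).map (Int.castRingHom ℤ_[2]))).trans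
              (baseChange_twoAdicModel W))).symm (c m) ∈
            kernel (Valued.v (R := PadicAlgCl 2)) (genFibΩ 2 ((integralModelInt W).map (Int.castRingHom ℤ_[2]))) ∧
          ptLogΩ 2 ((integralModelInt W).map (Int.castRingHom ℤ_[2]))
            ((toLoc ((genFibΩ_eq_baseChange ((integralModelInt W).map (Int.castRingHom ℤ_[2]))).trans
              (baseChange_twoAdicModel W))).symm (c m)) = ell 2 m)
    (hd : ∀ n, d n = 3 • (c (n + 2) + σ (n + 2) • c (n + 2)) - 2 • c 1)
    (n : ℕ) (ρ : Field.absoluteGaloisGroup ℚ_[2]) :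
    haveI := isIntegral_genFib_baseChange 2 ((integralModelInt W).map (Int.castRingHom ℤ_[2]))
    ptLogΩ 2 ((integralModelInt W).map (Int.castRingHom ℤ_[2]))
        ((toLoc ((genFibΩ_eq_baseChange ((integralModelInt W).map (Int.castRingHom ℤ_[2]))).trans
          (baseChange_twoAdicModel W))).symm (ρ • d n)) =
      ρ • (3 * (ell 2 (n + 2) + σ (n + 2) • ell 2 (n + 2)) - 2 * ell 2 1) := by
  set M : WeierstrassCurve ℤ_[2] := (integralModelInt W).map (Int.castRingHom ℤ_[2]) with hM
  haveI := isElliptic_coe_twoAdicModel W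
  haveI hintΩ := isIntegral_genFib_baseChange 2 M
  set hV := (genFibΩ_eq_baseChange M).trans (baseChange_twoAdicModel W) with hVdef
  set act : Field.absoluteGaloisGroup ℚ_[2] → (genFibΩ 2 M).toAffine.Point → (genFibΩ 2 M).toAffine.Point :=
    fun τ P ↦ (toLoc hV).symm (τ • toLoc hV P) with hact
  obtain ⟨hcL, hck, hcℓ⟩ := hcΩ (n + 2)
  obtain ⟨hc₁L, hc₁k, hc₁ℓ⟩ := hcΩ 1
  have hpt : (toLoc hV).symm (ρ • d n) =
      act ρ ((3 : ℕ) • ((toLoc hV).symm (c (n + 2)) + act (σ (n + 2)) ((toLoc hV).symm (c (n + 2)))) -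
        (2 : ℕ) • (toLoc hV).symm (c 1)) := by
    rw [hd n, hact]
    simp only [map_sub, map_nsmul, map_add, AddEquiv.apply_symm_apply]
  rw [hpt]
  exact ptLogΩ_act_plusPoint act (act_zero hV) (act_some hV) (σ (n + 2)) ρ (by omega : 1 ≤ n + 2)
    hcL hck hcℓ hc₁L hc₁k hc₁ℓ

end Log

/-! ## §2 The values at the bottom of the tower: `ℓ_1 = −2`, `ℓ_2 + σℓ_2 = −2`, `ℓ_3 = ζ_8` -/

/-- `ℓ_3 = (ζ_8 − 1) − (ζ_2 − 1)/2 + 0 = ζ_8` at `p = 2`. [cite: Kobayashi2003, §8.4] -/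
theorem ell_two_three : ell 2 3 = zeta 2 3 := by
  rw [ell, Finset.sum_range_succ, Finset.sum_range_succ, Finset.sum_range_one]
  have h1 : zeta 2 1 = -1 := by
    have h := isPrimitiveRoot_zeta 2 1
    rw [pow_one] at h
    exact h.eq_neg_one_of_two_right
  norm_num [h1]

/-- **`n = 0`: `3(ℓ_2 + σℓ_2) − 2ℓ_1 = −2`** for an inverter `σ` of `ζ_4` (`ℓ_2 + σℓ_2 = −2`, `ℓ_1 = −2`). [cite: KuriharaOtsuki2006, §1.3] -/
theorem plusLog_zero_eq {σ : Field.absoluteGaloisGroup ℚ_[2]} (hσ : σ • zeta 2 2 = (zeta 2 2)⁻¹) :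
    3 * (ell 2 2 + σ • ell 2 2) - 2 * ell 2 1 = -2 := by
  rw [ell_two_two_add_smul hσ, ell_two_one]; norm_num

/-- **`n = 1`: `X + g₀•X = 8`** for `X = 3(ℓ_3 + σℓ_3) − 2ℓ_1 = 3(ζ_8 + ζ_8⁻¹) + 4`, `σζ_8 = ζ_8⁻¹`, `g₀ζ_8 = ζ_8⁵ = −ζ_8`.
[cite: Kobayashi2003, §8.4, Prop. 8.26] -/
theorem plusLog_one_add_smul_eq {σ g₀ : Field.absoluteGaloisGroup ℚ_[2]} (hσ : σ • zeta 2 3 = (zeta 2 3)⁻¹)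
    (hg₀ : g₀ • zeta 2 3 = zeta 2 3 ^ 5) :
    (3 * (ell 2 3 + σ • ell 2 3) - 2 * ell 2 1) + g₀ • (3 * (ell 2 3 + σ • ell 2 3) - 2 * ell 2 1) = 8 := by
  have hζ4 : zeta 2 3 ^ 4 = -1 := by
    have h := zeta_add_pow 2 1 2
    rw [show (1 + 2 : ℕ) = 3 from rfl, show (2 ^ 2 : ℕ) = 4 from rfl] at h
    rw [h]
    have h1 := isPrimitiveRoot_zeta 2 1
    rw [pow_one] at h1
    exact h1.eq_neg_one_of_two_right
  have hζ0 : zeta 2 3 ≠ 0 := (isPrimitiveRoot_zeta 2 3).ne_zero (by norm_num)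
  have h5 : zeta 2 3 ^ 5 = -zeta 2 3 := by
    rw [show (5 : ℕ) = 4 + 1 from rfl, pow_add, hζ4, pow_one, neg_one_mul]
  have h3 : g₀ • (3 : PadicAlgCl 2) = 3 := by rw [Field.absoluteGaloisGroup.smul_def, map_ofNat]
  have h2 : g₀ • (2 : PadicAlgCl 2) = 2 := by rw [Field.absoluteGaloisGroup.smul_def, map_ofNat]
  rw [ell_two_three, ell_two_one, hσ, smul_sub, smul_mul', smul_mul', smul_add, smul_inv'', hg₀, h5, h3, h2,
    smul_neg, h2, inv_neg]
  ring

/-! ## §3 The base cases of the log side of (ERL_χ) for the displayed Honda system -/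

section Base

variable (W : WeierstrassCurve ℚ) [W.IsElliptic] [W.IsGloballyMinimal]
  {c : ℕ → localPoints W ℚ_[2]} {σ : ℕ → Field.absoluteGaloisGroup ℚ_[2]} {d : ℕ → localPoints W ℚ_[2]}

/-- **`Λ(toLoc⁻¹(d_0)) = −2`** for the displayed plus Honda system. [cite: KuriharaOtsuki2006, §1.3] [cite: Kobayashi2003, §8.4] -/
theorem ptLogΩ_plusHondaPoint_zero
    (hcΩ : haveI := isIntegral_genFib_baseChange 2 ((integralModelInt W).map (Int.castRingHom ℤ_[2]))
        ∀ m, (toLoc ((genFibΩ_eq_baseChange ((integralModelInt W).map (Int.castRingHom ℤ_[2]))).trans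
              (baseChange_twoAdicModel W))).symm (c m) ∈
            subfieldPoints (genFibΩ 2 ((integralModelInt W).map (Int.castRingHom ℤ_[2]))) (layer 2 m).toSubfield
              coeffs_mem_layer ∧
          (toLoc ((genFibΩ_eq_baseChange ((integralModelInt W).map (Int.castRingHom ℤ_[2]))).trans
              (baseChange_twoAdicModel W))).symm (c m) ∈
            kernel (Valued.v (R := PadicAlgCl 2)) (genFibΩ 2 ((integralModelInt W).map (Int.castRingHom ℤ_[2]))) ∧
          ptLogΩ 2 ((integralModelInt W).map (Int.castRingHom ℤ_[2]))
            ((toLoc ((genFibΩ_eq_baseChange ((integralModelInt W).map (Int.castRingHom ℤ_[2]))).trans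
              (baseChange_twoAdicModel W))).symm (c m)) = ell 2 m)
    (hσ : ∀ m, 1 ≤ m → σ m • zeta 2 m = (zeta 2 m)⁻¹)
    (hd : ∀ n, d n = 3 • (c (n + 2) + σ (n + 2) • c (n + 2)) - 2 • c 1) :
    haveI := isIntegral_genFib_baseChange 2 ((integralModelInt W).map (Int.castRingHom ℤ_[2]))
    ptLogΩ 2 ((integralModelInt W).map (Int.castRingHom ℤ_[2]))
        ((toLoc ((genFibΩ_eq_baseChange ((integralModelInt W).map (Int.castRingHom ℤ_[2]))).trans
          (baseChange_twoAdicModel W))).symm (d 0)) = -2 := by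
  have h := ptLogΩ_smul_plusHondaPoint_eq W hcΩ hd 0 1
  rw [one_smul, one_smul] at h
  rw [h]
  exact plusLog_zero_eq (hσ 2 (by norm_num))

/-- **`Λ(toLoc⁻¹(d_1)) + Λ(toLoc⁻¹(g₀ • d_1)) = 8`** for the displayed plus Honda system and any `g₀` with `g₀ζ_8 = ζ_8⁵`.
[cite: Kobayashi2003, §8.4, Prop. 8.26] -/
theorem ptLogΩ_plusHondaPoint_one_add_smul
    (hcΩ : haveI := isIntegral_genFib_baseChange 2 ((integralModelInt W).map (Int.castRingHom ℤ_[2]))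
        ∀ m, (toLoc ((genFibΩ_eq_baseChange ((integralModelInt W).map (Int.castRingHom ℤ_[2]))).trans
              (baseChange_twoAdicModel W))).symm (c m) ∈
            subfieldPoints (genFibΩ 2 ((integralModelInt W).map (Int.castRingHom ℤ_[2]))) (layer 2 m).toSubfield
              coeffs_mem_layer ∧
          (toLoc ((genFibΩ_eq_baseChange ((integralModelInt W).map (Int.castRingHom ℤ_[2]))).trans
              (baseChange_twoAdicModel W))).symm (c m) ∈
            kernel (Valued.v (R := PadicAlgCl 2)) (genFibΩ 2 ((integralModelInt W).map (Int.castRingHom ℤ_[2]))) ∧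
          ptLogΩ 2 ((integralModelInt W).map (Int.castRingHom ℤ_[2]))
            ((toLoc ((genFibΩ_eq_baseChange ((integralModelInt W).map (Int.castRingHom ℤ_[2]))).trans
              (baseChange_twoAdicModel W))).symm (c m)) = ell 2 m)
    (hσ : ∀ m, 1 ≤ m → σ m • zeta 2 m = (zeta 2 m)⁻¹)
    (hd : ∀ n, d n = 3 • (c (n + 2) + σ (n + 2) • c (n + 2)) - 2 • c 1)
    {g₀ : Field.absoluteGaloisGroup ℚ_[2]} (hg₀ : g₀ • zeta 2 3 = zeta 2 3 ^ 5) :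
    haveI := isIntegral_genFib_baseChange 2 ((integralModelInt W).map (Int.castRingHom ℤ_[2]))
    ptLogΩ 2 ((integralModelInt W).map (Int.castRingHom ℤ_[2]))
        ((toLoc ((genFibΩ_eq_baseChange ((integralModelInt W).map (Int.castRingHom ℤ_[2]))).trans
          (baseChange_twoAdicModel W))).symm (d 1)) +
      ptLogΩ 2 ((integralModelInt W).map (Int.castRingHom ℤ_[2]))
        ((toLoc ((genFibΩ_eq_baseChange ((integralModelInt W).map (Int.castRingHom ℤ_[2]))).trans
          (baseChange_twoAdicModel W))).symm (g₀ • d 1)) = 8 := by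
  have h1 := ptLogΩ_smul_plusHondaPoint_eq W hcΩ hd 1 1
  rw [one_smul, one_smul] at h1
  rw [h1, ptLogΩ_smul_plusHondaPoint_eq W hcΩ hd 1 g₀]
  exact plusLog_one_add_smul_eq (hσ 3 (by norm_num)) hg₀

/-- **Base case `n = 0` of the log side of (ERL_χ) in the pairing-sum enumeration**: for EVERY Dirichlet character `χ` modulo `4`,
`Σ_{j<1} χ(5)ʲ · Λ(toLoc⁻¹(g₀ʲ • d_0)) = Λ(toLoc⁻¹(d_0)) = −2`. [cite: Kobayashi2003, §8.4, Prop. 8.26] -/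
theorem sum_pow_mul_ptLogΩ_pow_smul_plusHondaPoint_eq_level_zero
    (hcΩ : haveI := isIntegral_genFib_baseChange 2 ((integralModelInt W).map (Int.castRingHom ℤ_[2]))
        ∀ m, (toLoc ((genFibΩ_eq_baseChange ((integralModelInt W).map (Int.castRingHom ℤ_[2]))).trans
              (baseChange_twoAdicModel W))).symm (c m) ∈
            subfieldPoints (genFibΩ 2 ((integralModelInt W).map (Int.castRingHom ℤ_[2]))) (layer 2 m).toSubfield
              coeffs_mem_layer ∧
          (toLoc ((genFibΩ_eq_baseChange ((integralModelInt W).map (Int.castRingHom ℤ_[2]))).trans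
              (baseChange_twoAdicModel W))).symm (c m) ∈
            kernel (Valued.v (R := PadicAlgCl 2)) (genFibΩ 2 ((integralModelInt W).map (Int.castRingHom ℤ_[2]))) ∧
          ptLogΩ 2 ((integralModelInt W).map (Int.castRingHom ℤ_[2]))
            ((toLoc ((genFibΩ_eq_baseChange ((integralModelInt W).map (Int.castRingHom ℤ_[2]))).trans
              (baseChange_twoAdicModel W))).symm (c m)) = ell 2 m)
    (hσ : ∀ m, 1 ≤ m → σ m • zeta 2 m = (zeta 2 m)⁻¹)
    (hd : ∀ n, d n = 3 • (c (n + 2) + σ (n + 2) • c (n + 2)) - 2 • c 1)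
    (g₀ : Field.absoluteGaloisGroup ℚ_[2]) (χ : DirichletCharacter (PadicAlgCl 2) (2 ^ (0 + 2))) :
    haveI := isIntegral_genFib_baseChange 2 ((integralModelInt W).map (Int.castRingHom ℤ_[2]))
    ∑ j ∈ Finset.range (2 ^ 0), χ (5 : ZMod (2 ^ (0 + 2))) ^ j *
        ptLogΩ 2 ((integralModelInt W).map (Int.castRingHom ℤ_[2]))
          ((toLoc ((genFibΩ_eq_baseChange ((integralModelInt W).map (Int.castRingHom ℤ_[2]))).trans
            (baseChange_twoAdicModel W))).symm (g₀ ^ j • d 0)) = -2 := by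
  rw [pow_zero, Finset.sum_range_one, pow_zero, pow_zero, one_smul, one_mul]
  exact ptLogΩ_plusHondaPoint_zero W hcΩ hσ hd

/-- **Base case `n = 1`, trivial character, of the log side of (ERL_χ) in the pairing-sum enumeration**: for `g₀ζ_8 = ζ_8⁵`,
`Σ_{j<2} 𝟙(5)ʲ · Λ(toLoc⁻¹(g₀ʲ • d_1)) = Λ(toLoc⁻¹(d_1)) + Λ(toLoc⁻¹(g₀ • d_1)) = 8`. [cite: Kobayashi2003, §8.4, Prop. 8.26] -/
theorem sum_pow_mul_ptLogΩ_pow_smul_plusHondaPoint_eq_one_level_one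
    (hcΩ : haveI := isIntegral_genFib_baseChange 2 ((integralModelInt W).map (Int.castRingHom ℤ_[2]))
        ∀ m, (toLoc ((genFibΩ_eq_baseChange ((integralModelInt W).map (Int.castRingHom ℤ_[2]))).trans
              (baseChange_twoAdicModel W))).symm (c m) ∈
            subfieldPoints (genFibΩ 2 ((integralModelInt W).map (Int.castRingHom ℤ_[2]))) (layer 2 m).toSubfield
              coeffs_mem_layer ∧
          (toLoc ((genFibΩ_eq_baseChange ((integralModelInt W).map (Int.castRingHom ℤ_[2]))).trans
              (baseChange_twoAdicModel W))).symm (c m) ∈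
            kernel (Valued.v (R := PadicAlgCl 2)) (genFibΩ 2 ((integralModelInt W).map (Int.castRingHom ℤ_[2]))) ∧
          ptLogΩ 2 ((integralModelInt W).map (Int.castRingHom ℤ_[2]))
            ((toLoc ((genFibΩ_eq_baseChange ((integralModelInt W).map (Int.castRingHom ℤ_[2]))).trans
              (baseChange_twoAdicModel W))).symm (c m)) = ell 2 m)
    (hσ : ∀ m, 1 ≤ m → σ m • zeta 2 m = (zeta 2 m)⁻¹)
    (hd : ∀ n, d n = 3 • (c (n + 2) + σ (n + 2) • c (n + 2)) - 2 • c 1)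
    {g₀ : Field.absoluteGaloisGroup ℚ_[2]} (hg₀ : g₀ • zeta 2 3 = zeta 2 3 ^ 5) :
    haveI := isIntegral_genFib_baseChange 2 ((integralModelInt W).map (Int.castRingHom ℤ_[2]))
    ∑ j ∈ Finset.range (2 ^ 1), (1 : DirichletCharacter (PadicAlgCl 2) (2 ^ (1 + 2))) (5 : ZMod (2 ^ (1 + 2))) ^ j *
        ptLogΩ 2 ((integralModelInt W).map (Int.castRingHom ℤ_[2]))
          ((toLoc ((genFibΩ_eq_baseChange ((integralModelInt W).map (Int.castRingHom ℤ_[2]))).trans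
            (baseChange_twoAdicModel W))).symm (g₀ ^ j • d 1)) = 8 := by
  have h5 : (1 : DirichletCharacter (PadicAlgCl 2) (2 ^ (1 + 2))) (5 : ZMod (2 ^ (1 + 2))) = 1 := by
    refine MulChar.one_apply ?_
    exact (ZMod.isUnit_iff_coprime 5 (2 ^ (1 + 2))).mpr (by norm_num)
  rw [h5, pow_one, Finset.sum_range_succ, Finset.sum_range_one, one_pow, one_pow, one_mul, one_mul, pow_zero, one_smul,
    pow_one]
  exact ptLogΩ_plusHondaPoint_one_add_smul W hcΩ hσ hd hg₀

end Base

end Summit.BirchSwinnertonDyer.BirchSwinnertonDyer.Theorems.SignedKatoOffTwo.LocalVar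

end
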